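import Mathlib
import Summits.PneNP.PneNP.Theorems.ResolutionUncertainty.Negative.ShadowSeparators

/-!
# `ResolutionUncertainty` (stmt-PneNP-9816), negative side of line `jukna-game-monotone-interpolation`:
# the repaired engine is carried by the BAD Alice cliques alone

Support file of the deep refuter (drefute gen 3). The lead's repair of stub 2 adds
`H.CliqueFree (kA + kB)` (and `Hᶜ.CliqueFree (kA + kB)`) to `ShadowLowerBound`. On a
`K_{kA+kB}`-free graph we exhibit, for every finset `Bad` of `kA`-cliques containing every
`kA`-clique `x ⊆ A` with at least `kB` common neighbours in `B`, a monotone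
`{∧₂, ∨₂, 0, 1}`-circuit of size

  `≤ 3 + |B| (n + 2 kB + 1) + |Bad| (n + 2)`

accepting `1_x` for EVERY `kA`-clique `x ⊆ A` and rejecting the shadow `1_{A ∩ N(y)}` of every
`kB`-clique `y ⊆ B` (`exists_separator_of_badCover`): the Bob-threshold separator of
`ShadowSeparators.lean` OR-ed with the minterms `⋀_{v ∈ x} z_v` of the bad cliques (a minterm
of a clique `x` fires on a shadow `A ∩ N(y)` only if `x ∪ y` is a `(kA + kB)`-clique).

Consequence for the line (calibration, read contrapositively): any lower bound
`n^{ε log₂ n} ≤ C.size` for the repaired engine on a split `(H, A, B, kA, kB)` forces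
`#{bad kA-cliques of A} ≥ (n^{ε log₂ n} - 3 - |B|(n + 2kB + 1)) / (n + 2)` — the engine contains
the purely extremal statement "Ramsey rich splits have `n^{Ω(log n)}` bad cliques", and no
distributional (approximation-method) argument whose positive test inputs are mostly GOOD
cliques can prove it (the threshold separator alone is polynomial and errs on no shadow). In
`G(n, ½)` with `kB = κ log₂ n` the bad cliques number `n^{(κ²/2 + o(1)) log₂ n}`, so
`ε(η, c) ≤ κ²/2 ≈ (3c)²/2` there (paper estimate, drefute g3 notes). [folklore]
-/

-- `Summit.PneNP.PneNP.…` repeats `PneNP` by the tree's layout (summit = problem).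
set_option linter.dupNamespace false

namespace Summit.PneNP.PneNP.Theorems.ResolutionUncertainty.Negative

open Literature.Computability.Complexity

universe u

section Generic

variable {ι : Type u}

/-- The AND of the inputs listed in `T` (`true` for the empty list): `|T| + 1` gates.
[folklore] -/
theorem cktSize_listAnd (T : List ι) :
    CktSize monotoneBasis01 (fun (x : ι → Bool) (_ : Unit) => T.all x) (T.length + 1) := by
  induction T with
  | nil => exact (cktSize_const_mono01 ι true).congr fun x _ => by simp
  | cons i T ih =>
    have h1 : CktSize monotoneBasis01
        (fun (x : ι → Bool) => Sum.elim x (fun (_ : Unit) => T.all x)) (0 + (T.length + 1)) :=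
      (CktSize.id _).pair ih
    have h2 : CktSize monotoneBasis01
        (fun (y : ι ⊕ Unit → Bool) (_ : Unit) => (y (.inl i) && y (.inr ()))) 1 :=
      cktSize_and01 _ _
    refine ((h1.comp h2).of_le (by simp)).congr fun x _ => ?_
    simp [List.all_cons]

/-- The OR of finitely many single-output programs on the same inputs: the sizes add, plus
`card κ + 1` gates for the OR-chain. [folklore] -/
theorem cktSize_existsOr {κ : Type*} [Fintype κ] {g : (ι → Bool) → κ → Bool} {s : κ → ℕ}
    (h : ∀ k, CktSize monotoneBasis01 (fun x (_ : Unit) => g x k) (s k)) :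
    CktSize monotoneBasis01 (fun x (_ : Unit) => decide (∃ k, g x k = true))
      ((∑ k, s k) + ((Finset.univ : Finset κ).toList.length + 1)) := by
  classical
  have h1 : CktSize monotoneBasis01 g (∑ k, s k) := CktSize.pi h
  have h2 := cktSize_listOr (ι := κ) (Finset.univ : Finset κ).toList
  refine (h1.comp h2).congr fun x _ => ?_
  rw [Bool.eq_iff_iff, List.any_eq_true, decide_eq_true_iff]
  simp

end Generic

variable {n : ℕ}

/-- **The repaired engine lives on the bad cliques.** Let `H` be `K_{kA+kB}`-free, `1 ≤ kB`, and
let `Bad` be any finset of `kA`-cliques containing every `kA`-clique `x ⊆ A` with at least `kB`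
common neighbours in `B`. Then a monotone `{∧₂, ∨₂, 0, 1}`-circuit with at most
`3 + |B| (n + 2 kB + 1) + |Bad| (n + 2)` gates accepts `1_x` for every `kA`-clique `x ⊆ A` and
rejects `1_{A ∩ N(y)}` for every `kB`-clique `y ⊆ B`: the Bob-threshold separator OR the
minterms of the bad cliques (a bad minterm `⋀_{v∈x} z_v` fires on a shadow `A ∩ N(y)` only if
`x ⊆ N(y)`, i.e. `x ∪ y` is a `(kA+kB)`-clique). So `n^{ε log n} ≤ C.size` for all such
separators forces `|Bad| ≥ (n^{ε log n} - 3 - |B|(n + 2kB + 1)) / (n + 2)`. [folklore] -/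
theorem exists_separator_of_badCover (H : SimpleGraph (Fin n)) [DecidableRel H.Adj]
    (A B : Finset (Fin n)) (kA kB : ℕ) (hkB : 1 ≤ kB) (hfree : H.CliqueFree (kA + kB))
    (Bad : Finset (Finset (Fin n)))
    (hcover : ∀ x : Finset (Fin n), x ⊆ A → H.IsNClique kA x →
      kB ≤ (B.filter fun w => ∀ v ∈ x, H.Adj v w).card → x ∈ Bad)
    (hBad : ∀ x ∈ Bad, H.IsNClique kA x) :
    ∃ C : Circuit (Fin n), C.IsOver monotoneBasis01 ∧
      C.size ≤ 3 + B.card * (n + 2 * kB + 1) + Bad.card * (n + 2) ∧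
      (∀ x : Finset (Fin n), x ⊆ A → H.IsNClique kA x →
        C.eval (fun v => decide (v ∈ x)) = true) ∧
      (∀ y : Finset (Fin n), y ⊆ B → H.IsNClique kB y →
        C.eval (fun v => decide (v ∈ A ∧ ∀ w ∈ y, H.Adj v w)) = false) := by
  classical
  obtain ⟨f, hf, hacc, hrej⟩ := exists_cktSize_threshold H A B kB hkB
  -- the minterms of the bad cliques, OR-ed together
  have hmin : CktSize monotoneBasis01 (fun (z : Fin n → Bool) (_ : Unit) =>
      decide (∃ x : ↥Bad, (x : Finset (Fin n)).toList.all z = true))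
      ((∑ x : ↥Bad, ((x : Finset (Fin n)).toList.length + 1)) +
        ((Finset.univ : Finset ↥Bad).toList.length + 1)) :=
    cktSize_existsOr fun x : ↥Bad => cktSize_listAnd (x : Finset (Fin n)).toList
  have hmin' : CktSize monotoneBasis01 (fun (z : Fin n → Bool) (_ : Unit) =>
      decide (∃ x : ↥Bad, (x : Finset (Fin n)).toList.all z = true)) (Bad.card * (n + 2) + 1) := by
    refine hmin.of_le ?_
    have hsum : ∑ x : ↥Bad, ((x : Finset (Fin n)).toList.length + 1) ≤ Bad.card * (n + 1) := by
      calc ∑ x : ↥Bad, ((x : Finset (Fin n)).toList.length + 1) ≤ ∑ _x : ↥Bad, (n + 1) :=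
            Finset.sum_le_sum fun x _ => by
              rw [Finset.length_toList]
              exact Nat.add_le_add_right ((Finset.card_le_univ _).trans (by simp)) 1
        _ = Bad.card * (n + 1) := by simp
    have hc : (Finset.univ : Finset ↥Bad).toList.length = Bad.card := by simp
    rw [hc]
    nlinarith [hsum]
  -- threshold OR minterms
  have hboth := (hf.pair hmin').comp (cktSize_or01 (ι := Unit ⊕ Unit) (.inl ()) (.inr ()))
  obtain ⟨C, hC, hsize, heval⟩ :=
    (hboth.of_le (s' := 3 + B.card * (n + 2 * kB + 1) + Bad.card * (n + 2)) (by ring_nf; omega)).toCircuit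
  refine ⟨C, hC, hsize, fun x hxA hx => ?_, fun y hyB hy => ?_⟩
  · rw [heval]
    simp only [Sum.elim_inl, Sum.elim_inr, Bool.or_eq_true, decide_eq_true_eq]
    by_cases hlt : (B.filter fun w => ∀ v ∈ x, H.Adj v w).card < kB
    · exact Or.inl (hacc x hxA hlt)
    · refine Or.inr ⟨⟨x, hcover x hxA hx (not_lt.1 hlt)⟩, ?_⟩
      simp [List.all_eq_true]
  · rw [heval]
    simp only [Sum.elim_inl, Sum.elim_inr, Bool.or_eq_false_iff, decide_eq_false_iff_not,
      not_exists]
    refine ⟨hrej y hyB hy.2.ge, fun x hall => ?_⟩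
    -- a bad minterm firing on the shadow of `y` gives the `(kA + kB)`-clique `x ∪ y`
    have hxB := hBad x x.2
    simp only [List.all_eq_true, Finset.mem_toList, decide_eq_true_eq] at hall
    have hdisj : Disjoint (x : Finset (Fin n)) y := by
      rw [Finset.disjoint_left]
      intro v hvx hvy
      exact H.irrefl ((hall v hvx).2 v hvy)
    refine hfree ((x : Finset (Fin n)) ∪ y)
      ⟨?_, by rw [Finset.card_union_of_disjoint hdisj, hxB.2, hy.2]⟩
    intro a ha b hb hab
    rw [Finset.coe_union, Set.mem_union] at ha hb
    rcases ha with ha | ha <;> rcases hb with hb | hb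
    · exact hxB.1 ha hb hab
    · exact (hall a ha).2 b hb
    · exact ((hall b hb).2 a ha).symm
    · exact hy.1 ha hb hab

end Summit.PneNP.PneNP.Theorems.ResolutionUncertainty.Negative
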